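import Literature.Probability.Percolation.OrbitLoopDarts
import Literature.Probability.Percolation.OrbitLoopPieces
import Literature.Probability.Percolation.PlateChartRoom
import HarnessLib

/-!
# From a connected crossing piece of the rounded loop of an orbit to an arc of the medial polygon

Topic `Literature/Probability/Percolation`; proofs only.  Given a periodic corner `q` of a bond
configuration `ω` of `ℤ²`, a chart `Φ` with room `(ρ, ν)` on `plateBox 2 2`, and a connected
subset `C` of the chart pull-back of the trace of the rounded loop `Λ = OrbitPolygon.loop ω q δ`
inside a chart box `plateBox a₀ b₀` meeting both vertical sides of the box, **the based medial
polygon of the orbit loop re-based at a suitable corner has a parameter interval `[0, t₁]` whose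
image lies in `Φ(plateBox (a₀+ν) (b₀+ν))` and comes `ν`-close (in the chart) to both vertical
sides** (`exists_arc_of_run`): the pieces of `Λ` meeting `Φ(C)` form a cyclic run
(`OrbitPolygon.exists_run_of_isPreconnected`), the darts along the run are `2δ`-close to it
(`dist_dart_piece_le`), and the medial polygon is `(√2/8)δ`-close to `Λ` at equal times
(`IsInterfaceLoop.dist_closedCurve_loop_le_sharp`).  This is the step "a connected crossing part
of a cluster interface is a crossing sub-arc of the interface loop" of the loops-determine-crossings
dictionary (Camia–Newman, CMP 268 (2006), §5).

## References

* F. Camia, C. M. Newman, Comm. Math. Phys. 268 (2006), §5 [CamiaNewman2006].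
-/

noncomputable section

namespace Literature.Probability.Percolation

open Literature.Probability.RandomPlanarGeometry
open Literature.Probability.LatticeModels
open Filter Topology Set Metric Complex Function OrbitPolygon

/-- **Points of the run are `δ`-close to the re-based arc**: with the notation of
`exists_arc_of_run` (run `m₀, …, m₀ + k` of pieces of the rounded loop of `q`, re-based corner
`q' = corner ω q (m₀/2)`, arc `[0, L/Q]` of the medial polygon of `orbitLoop ω q'` with
`L = min ((m₀+k+1)/2 - m₀/2 + 1) Q`), every point `Φ z` covered by the run is within `δ` of a
point of the arc (time of the point on its piece + sharp closeness
`IsInterfaceLoop.dist_closedCurve_loop_le_sharp`). [cite: CamiaNewman2006, §5] -/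
theorem side_point_of_run {ω : BondConfig (Site 2)} {q : Site 2 × Fin 4} (hq : q ∈ periodicPts (nextCorner ω))
    {δ : ℝ} (hδ : 0 < δ) {Φ : ℂ ≃ₜ ℂ} {C : Set ℂ} {m₀ k : ℕ}
    (hcover : Φ '' C ⊆ ⋃ i ∈ Finset.range (k + 1), OrbitPolygon.piece ω q δ (m₀ + i))
    {z : ℂ} (hz : z ∈ C) :
    ∃ u ∈ Icc (0 : unitInterval)
        ⟨min (((min ((m₀ + k + 1) / 2 - m₀ / 2 + 1) (minimalPeriod (nextCorner ω) q) : ℕ) : ℝ) /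
            minimalPeriod (nextCorner ω) q) 1, le_min (by positivity) zero_le_one, min_le_right _ _⟩,
      dist (closedCurve ((orbitLoop ω (OrbitPolygon.corner ω q (m₀ / 2))).map (medialPoint δ)) u) (Φ z) ≤ δ := by
  set Q := minimalPeriod (nextCorner ω) q with hQdef
  set L := min ((m₀ + k + 1) / 2 - m₀ / 2 + 1) Q with hL
  have hQ3 : 3 ≤ Q := three_le_period hq
  have hQpos : 0 < Q := by omega
  have hQr : (0 : ℝ) < Q := by exact_mod_cast hQpos
  set j₁ := m₀ / 2 with hj₁
  set q' := OrbitPolygon.corner ω q j₁ with hq'def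
  have hq' : q' ∈ periodicPts (nextCorner ω) := corner_mem_periodicPts hq j₁
  have hQ' : minimalPeriod (nextCorner ω) q' = Q := minimalPeriod_corner hq j₁
  have hγ'il : IsInterfaceLoop ω (orbitLoop ω q') := isInterfaceLoop_orbitLoop hq'
  -- `Φ z` lies on a piece of the run, read in the re-based indexing
  have hw : Φ z ∈ Φ '' C := mem_image_of_mem _ hz
  have := hcover hw
  simp only [mem_iUnion, Finset.mem_range, exists_prop] at this
  obtain ⟨i, hi, hwi⟩ := this
  set m' := m₀ + i - 2 * j₁ with hm'
  have hm'eq : m' + 2 * j₁ = m₀ + i := by rw [hm', hj₁]; omega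
  have hwi' : Φ z ∈ OrbitPolygon.piece ω q' δ m' := by rw [hq'def, piece_corner, hm'eq]; exact hwi
  set m'' := m' % (2 * Q) with hm''
  have hm''Q : m'' < 2 * Q := Nat.mod_lt _ (by omega)
  have hm''lt : m'' < 2 * minimalPeriod (nextCorner ω) q' := by rw [hQ']; exact hm''Q
  have hwi'' : Φ z ∈ OrbitPolygon.piece ω q' δ m'' := by rw [hm'', ← hQ', piece_mod]; exact hwi'
  obtain ⟨t, -, ht2, ht3, ht4, hloop⟩ := exists_time_of_mem_piece hq' δ hm''lt hwi''
  have hm''le : m'' ≤ m' := Nat.mod_le _ _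
  have hm'le : m' ≤ k + 1 := by omega
  have hkey : m'' + 1 ≤ 2 * L := by
    rw [hL]
    rcases le_total ((m₀ + k + 1) / 2 - m₀ / 2 + 1) Q with h | h
    · rw [min_eq_left h]; omega
    · rw [min_eq_right h]; omega
  -- `t ≤ L/Q` and `t ≤ 1`
  have htt₁ : t ≤ min ((L : ℝ) / Q) 1 := by
    refine le_min (ht2.trans ?_) ht3
    rw [hQ']
    have hkey' : ((m'' : ℝ) + 1) ≤ 2 * L := by exact_mod_cast hkey
    have h2Qr : (0 : ℝ) < ((2 * Q : ℕ) : ℝ) := by positivity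
    calc ((m'' : ℝ) + 1) / ((2 * Q : ℕ) : ℝ) ≤ (2 * (L : ℝ)) / ((2 * Q : ℕ) : ℝ) :=
          div_le_div_of_nonneg_right hkey' h2Qr.le
      _ = (L : ℝ) / Q := by push_cast; field_simp
  refine ⟨⟨t, ht4, ht3⟩, ⟨by exact_mod_cast ht4, by exact_mod_cast htt₁⟩, ?_⟩
  have hsharp := hγ'il.dist_closedCurve_loop_le_sharp (hps_orbit hq') (hpt_orbit hq') hδ.le ⟨t, ht4, ht3⟩
  rw [hloop] at hsharp
  refine hsharp.trans ?_
  nlinarith [sqrt_two_le_three_halves, Real.sqrt_nonneg 2]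

/-- **From a connected crossing piece of the rounded loop to a loop arc.**  See the module
docstring. [cite: CamiaNewman2006, §5] -/
theorem exists_arc_of_run {ω : BondConfig (Site 2)} {q : Site 2 × Fin 4} (hq : q ∈ periodicPts (nextCorner ω))
    {δ : ℝ} (hδ : 0 < δ) (Φ : ℂ ≃ₜ ℂ) {ν ρ : ℝ}
    (hroom : ∀ z ∈ plateBox 2 2, ∀ p : ℂ, dist p (Φ z) ≤ ρ → dist (Φ.symm p) z ≤ ν) (h2δ : 2 * δ ≤ ρ)
    {a₀ b₀ : ℝ} (ha₀ : a₀ ≤ 2) (hb₀ : b₀ ≤ 2)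
    {C : Set ℂ} (hCsub : C ⊆ Φ.symm '' range (OrbitPolygon.loop ω q δ) ∩ plateBox a₀ b₀)
    (hCc : IsPreconnected C) (hCl : ∃ z ∈ C, z.re = -a₀) (hCr : ∃ z ∈ C, z.re = a₀) :
    ∃ (j₁ : ℕ) (α : Curve ℂ) (t₁ : unitInterval),
      CurveClass.mk α = loopCurve δ 0 (orbitLoop ω (OrbitPolygon.corner ω q j₁)) ∧
      (∀ u ∈ Icc 0 t₁, α u ∈ Φ '' plateBox (a₀ + ν) (b₀ + ν)) ∧
      (∃ u ∈ Icc 0 t₁, (Φ.symm (α u)).re ≤ -a₀ + ν) ∧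
      (∃ u ∈ Icc 0 t₁, a₀ - ν ≤ (Φ.symm (α u)).re) := by
  -- the run of pieces meeting `Φ(C)`
  set Λ := OrbitPolygon.loop ω q δ with hΛ
  set C' : Set ℂ := Φ '' C with hC'
  have hC'c : IsPreconnected C' := hCc.image _ Φ.continuous.continuousOn
  obtain ⟨zl, hzl, hzlre⟩ := hCl
  have hC'ne : C'.Nonempty := ⟨Φ zl, mem_image_of_mem _ hzl⟩
  have hC'sub : C' ⊆ range Λ := by
    rintro _ ⟨z, hz, rfl⟩
    obtain ⟨⟨w, hw, hwz⟩, -⟩ := hCsub hz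
    rw [← hwz, Homeomorph.apply_symm_apply]; exact hw
  have hCbox : ∀ z ∈ C, z ∈ plateBox a₀ b₀ := fun z hz ↦ (hCsub hz).2
  obtain ⟨m₀, k, hm₀, hk, hhits, hcover⟩ := exists_run_of_isPreconnected hq hδ hC'c hC'ne hC'sub
  set Q := minimalPeriod (nextCorner ω) q with hQdef
  have hQ3 : 3 ≤ Q := three_le_period hq
  have hQpos : 0 < Q := by omega
  -- re-base at the dart of the first piece of the run
  set j₁ := m₀ / 2 with hj₁
  set q' := OrbitPolygon.corner ω q j₁ with hq'def
  have hq' : q' ∈ periodicPts (nextCorner ω) := corner_mem_periodicPts hq j₁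
  have hQ' : minimalPeriod (nextCorner ω) q' = Q := minimalPeriod_corner hq j₁
  set γ' := orbitLoop ω q' with hγ'
  have hγ'il : IsInterfaceLoop ω γ' := isInterfaceLoop_orbitLoop hq'
  have hlen : γ'.length = Q := by rw [hγ', length_orbitLoop, hQ']
  -- the arc length in darts, capped at `Q`
  set L : ℕ := min ((m₀ + k + 1) / 2 - j₁ + 1) Q with hLdef
  have hL1 : 1 ≤ L := by
    rw [hLdef]; refine le_min (by omega) (by omega)
  have hLQ : L ≤ Q := min_le_right _ _
  have hLk : k + 2 ≤ 2 * ((m₀ + k + 1) / 2 - j₁ + 1) := by rw [hj₁]; omega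
  have hQr : (0 : ℝ) < Q := by exact_mod_cast hQpos
  set t₁r : ℝ := min ((L : ℝ) / Q) 1 with ht₁r
  have ht₁0 : 0 ≤ t₁r := le_min (by positivity) zero_le_one
  have ht₁1 : t₁r ≤ 1 := min_le_right _ _
  set t₁ : unitInterval := ⟨t₁r, ht₁0, ht₁1⟩ with ht₁
  set α : Curve ℂ := closedCurve (γ'.map (medialPoint δ)) with hαdef
  refine ⟨j₁, α, t₁, (IsInterfaceLoop.loopCurve_zero_eq_mk_closedCurve δ γ').symm, ?_, ?_, ?_⟩
  · -- the band: every point of the arc is on a dart near a piece of the run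
    intro u hu
    have hu0 : (0 : ℝ) ≤ u := u.2.1
    have hut : (u : ℝ) ≤ t₁r := hu.2
    have huL : (Q : ℝ) * u ≤ L := by
      have hut' : (u : ℝ) ≤ (L : ℝ) / Q := hut.trans (min_le_left _ _)
      have := mul_le_mul_of_nonneg_left hut' hQr.le
      rwa [mul_div_cancel₀ _ hQr.ne'] at this
    -- the dart index
    set kk : ℕ := min ⌊(Q : ℝ) * u⌋₊ (L - 1) with hkk
    have hkkL : kk ≤ L - 1 := min_le_right _ _
    have hkkN : kk < γ'.length := by rw [hlen]; omega
    have hkt : (γ'.length : ℝ) * u ∈ Icc (kk : ℝ) (kk + 1) := by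
      rw [hlen]
      have hfl := Nat.floor_le (mul_nonneg hQr.le hu0)
      have hlt := Nat.lt_floor_add_one ((Q : ℝ) * u)
      rcases le_or_gt ⌊(Q : ℝ) * u⌋₊ (L - 1) with h1 | h1
      · have : kk = ⌊(Q : ℝ) * u⌋₊ := min_eq_left h1
        rw [this]; exact ⟨hfl, hlt.le⟩
      · have hkk' : kk = L - 1 := min_eq_right h1.le
        rw [hkk']
        have h2 : (L : ℝ) ≤ ⌊(Q : ℝ) * u⌋₊ := by exact_mod_cast (show L ≤ ⌊(Q : ℝ) * u⌋₊ by omega)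
        have h3 : ((L - 1 : ℕ) : ℝ) = L - 1 := by rw [Nat.cast_sub hL1]; simp
        rw [h3]
        constructor <;> linarith
    have hmem := closedCurve_mem_dart hγ'il (hps_orbit hq') (hpt_orbit hq') δ hkkN hkt
    -- the dart `kk` of `q'` is the dart `jj = j₁ + kk` of `q`
    rw [hq'def, corner_corner] at hmem
    set jj := j₁ + kk with hjj
    -- a piece of the run along dart `jj`
    have hjj1 : 2 * jj ≤ m₀ + k + 1 := by
      have : kk + 1 ≤ (m₀ + k + 1) / 2 - j₁ + 1 := by omega
      omega
    have hjj2 : m₀ ≤ 2 * jj + 1 := by omega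
    obtain ⟨m, hmrun, hmcase⟩ : ∃ m, (m₀ ≤ m ∧ m ≤ m₀ + k) ∧
        (m = 2 * jj ∨ m = 2 * jj + 1 ∨ (1 ≤ jj ∧ m + 1 = 2 * jj)) := by
      rcases le_or_gt m₀ (2 * jj) with h1 | h1
      · rcases le_or_gt (2 * jj) (m₀ + k) with h2 | h2
        · exact ⟨2 * jj, ⟨h1, h2⟩, Or.inl rfl⟩
        · exact ⟨2 * jj - 1, ⟨by omega, by omega⟩, Or.inr (Or.inr ⟨by omega, by omega⟩)⟩
      · exact ⟨2 * jj + 1, ⟨by omega, by omega⟩, Or.inr (Or.inl rfl)⟩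
    obtain ⟨w, hwpiece, hwC'⟩ := hhits (m - m₀) (by omega)
    rw [show m₀ + (m - m₀) = m by omega] at hwpiece
    -- distance `≤ 2δ` between the arc point and `w`
    have hdist : dist (α u) w ≤ 2 * δ := by
      refine dist_dart_piece_le hδ.le hmem ?_
      rcases hmcase with rfl | rfl | ⟨hjj0, hm'⟩
      · left; rwa [OrbitPolygon.piece, segment_vtx_even] at hwpiece
      · right; left; rwa [OrbitPolygon.piece, segment_vtx_odd] at hwpiece
      · right; right
        refine ⟨hjj0, ?_⟩
        have hm2 : m = 2 * (jj - 1) + 1 := by omega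
        rw [hm2, OrbitPolygon.piece, segment_vtx_odd, show jj - 1 + 1 = jj by omega] at hwpiece
        exact hwpiece
    -- read in the chart
    obtain ⟨z, hzC, rfl⟩ := hwC'
    have hzbox := hCbox z hzC
    have hz2 : z ∈ plateBox 2 2 := plateBox_subset_two ha₀ hb₀ hzbox
    have hnear := chart_coords_near hroom hz2 (p := α u) (hdist.trans h2δ)
    refine mem_image_of_symm_mem ?_
    rw [mem_plateBox_iff_abs] at hzbox ⊢
    constructor
    · have := abs_sub_abs_le_abs_sub (Φ.symm (α u)).re z.re; linarith [hnear.1, hzbox.1]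
    · have := abs_sub_abs_le_abs_sub (Φ.symm (α u)).im z.im; linarith [hnear.2, hzbox.2]
  · -- the left side: the point of `C` on `re = -a₀`
    obtain ⟨u, hu, hclose⟩ := side_point_of_run hq hδ hcover hzl
    refine ⟨u, hu, ?_⟩
    have hzl2 : zl ∈ plateBox 2 2 := plateBox_subset_two ha₀ hb₀ (hCbox zl hzl)
    have hnear := chart_coords_near hroom hzl2 (p := α u) (hclose.trans (by linarith))
    have := (abs_le.1 hnear.1).2
    linarith
  · -- the right side: the point of `C` on `re = a₀`
    obtain ⟨zr, hzr, hzrre⟩ := hCr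
    obtain ⟨u, hu, hclose⟩ := side_point_of_run hq hδ hcover hzr
    refine ⟨u, hu, ?_⟩
    have hzr2 : zr ∈ plateBox 2 2 := plateBox_subset_two ha₀ hb₀ (hCbox zr hzr)
    have hnear := chart_coords_near hroom hzr2 (p := α u) (hclose.trans (by linarith))
    have := (abs_le.1 hnear.1).1
    linarith

end Literature.Probability.Percolation

end
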